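import Summits.BirchSwinnertonDyer.BirchSwinnertonDyer.Theorems.ErratumRoadFiveSigmaLocalMultQuotient
import Literature.NumberTheory.GaloisRepresentations.TameInertiaCoinvariantsEvaluationProofs
import Literature.NumberTheory.EllipticCurves.TateModuleFinrankProofs
import HarnessLib

/-!
# (S5-mult) rank inputs: unipotence of inertia on `E[p^∞]` (`hP`) and `rank_{ℤ_p} T_p Q = 1` for the
# inertia-coinvariant quotient at a multiplicative place (theorems only)

Cell `bsd-stepL`, K2 route `ErratumRoadFive`, support item 20495 `JSWSigmaLocalCharIdeal`, step (S5) at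
the finitely decomposed places of MULTIPLICATIVE reduction; seat `bsd-stepL-imc-p1` (g14). THEOREMS ONLY.

* `charpoly_eq_X_sub_C_of_forall_eq_smul`, `eq_unitsInv_mul_smul_of_units_smul_eq` — generic algebra;
* `exists_pow_prime_pow_apply_eq_of_mem_absInertia` — the hypothesis `hP` of the coinvariant evaluation
  isomorphism (`TameInertiaCoinvariantsEvaluationProofs`): `ρ(σ)^{p^k} a = a` for `σ ∈ I_w` (from
  `(ρ(σ) − 1)² = 0`, `primaryTorsionGaloisRep_inertia_smul_sub_eq`);
* `finrank_tateModule_quotient_eq_one` — `rank_{ℤ_p} T_p(E[p^∞] ⧸ D) = 1` (`T_p E ↠ T_p Q` kills `σx − x ≠ 0`;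
  rank–nullity over `ℚ_p` after `ℚ_p ⊗ −`; `T_p Q ≠ 0`).

References: [GreenbergVatsal2000] §2, proof of Prop. 2.4 (arXiv p. 22); [SilvermanATAEC1994] Thm. IV.10.2(a),
Ex. 5.13.
-/

noncomputable section

open scoped Classical TensorProduct
open Polynomial Field NumberField IsDedekindDomain WeierstrassCurve Module
open Literature.NumberTheory.EllipticCurves Literature.NumberTheory.GaloisRepresentations
  Literature.NumberTheory.EllipticCurves.BigGaloisRep
  Literature.NumberTheory.GaloisRepresentations.IsNonarchimedeanLocalField
  Literature.NumberTheory.EllipticCurves.JetchevSkinnerWan2017 Literature.NumberTheory.EllipticCurves.IwasawaCharacter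

set_option autoImplicit false
-- the Theorems namespace of this sub repeats the summit name by design (D-0017 nested layout)
set_option linter.dupNamespace false

namespace Summit.BirchSwinnertonDyer.BirchSwinnertonDyer.Theorems.SigmaLocal

open _root_.TopRep _root_.ContinuousCohomology

/-! ## §1 Generic: a pointwise-scalar endomorphism of a free module of rank one -/

section Generic

/-- If `f m = c • m` for all `m` on a free module of `finrank 1`, then `charpoly f = X − C c`. [folklore] -/
theorem charpoly_eq_X_sub_C_of_forall_eq_smul {R M : Type*} [CommRing R] [Nontrivial R] [AddCommGroup M]
    [Module R M] [Module.Free R M] [Module.Finite R M] (h1 : Module.finrank R M = 1) (f : M →ₗ[R] M)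
    (c : R) (hf : ∀ m, f m = c • m) : f.charpoly = X - C c := by
  let b := Module.finBasisOfFinrankEq R M h1
  have hmat : LinearMap.toMatrix b b f = Matrix.diagonal fun _ => c := by
    ext i j
    rw [LinearMap.toMatrix_apply, hf, map_smul, b.repr_self, Finsupp.smul_apply, Finsupp.single_apply,
      Matrix.diagonal_apply, smul_eq_mul]
    by_cases h : j = i
    · subst h; simp
    · rw [if_neg h, if_neg (Ne.symm h), mul_zero]
  rw [← LinearMap.charpoly_toMatrix f b, hmat, Matrix.charpoly_diagonal, Fin.prod_univ_one]

/-- `↑n • y = ε • t` with `n` a unit gives `y = (n⁻¹ ε) • t`. [folklore] -/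
theorem eq_unitsInv_mul_smul_of_units_smul_eq {R M : Type*} [CommRing R] [AddCommGroup M] [Module R M]
    (n : Rˣ) (ε : R) (y t : M) (h : (n : R) • y = ε • t) : y = ((↑n⁻¹ : R) * ε) • t := by
  rw [mul_smul, ← h, smul_smul, Units.inv_mul, one_smul]

end Generic

/-! ## §2 `rank T_p Q = 1` and the unipotence of inertia at a multiplicative place -/

section Mult

variable {K : Type} [Field K] [NumberField K] (E : WeierstrassCurve K) [E.IsElliptic]
  (p : ℕ) [Fact p.Prime] {w : HeightOneSpectrum (𝓞 K)}

/-- **Unipotence of inertia on `E[p^∞]` at a multiplicative `w ∤ p`** in the form `hP` of the coinvariant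
evaluation isomorphism: every `σ ∈ absInertia K_w` satisfies `ρ(σ)^{p^k} a = a` for some `k` (since
`(ρ(σ) − 1)² = 0`, `ρ(σ)ⁿ a = a + n • (ρ(σ)a − a)`). [cite: SilvermanATAEC1994, Ex. 5.13 (b)] -/
theorem exists_pow_prime_pow_apply_eq_of_mem_absInertia
    (hw : ((p : ℕ) : 𝓞 K) ∉ w.asIdeal) (hv : E.HasMultiplicativeReductionAt w)
    {σ : absoluteGaloisGroup (w.adicCompletion K)} (hσ : σ ∈ absInertia (w.adicCompletion K))
    (a : PrimaryTorsion (geomPoints E) p) :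
    ∃ k : ℕ, ((((E.primaryTorsionGaloisRep p).restrict (localMap K (Sum.inl w)) :
        ContinuousRep (absoluteGaloisGroup (w.adicCompletion K)) ℤ_[p] (PrimaryTorsion (geomPoints E) p)) σ) ^ p ^ k) a = a := by
  set ρ' : ContinuousRep (absoluteGaloisGroup (w.adicCompletion K)) ℤ_[p] (PrimaryTorsion (geomPoints E) p) :=
    (E.primaryTorsionGaloisRep p).restrict (localMap K (Sum.inl w)) with hρ'
  have hd : ρ' σ (ρ' σ a - a) = ρ' σ a - a := primaryTorsionGaloisRep_inertia_smul_sub_eq E p hw hv hσ hσ a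
  have hiter : ∀ n : ℕ, ((ρ' σ) ^ n) a = a + n • (ρ' σ a - a) := by
    intro n
    induction n with
    | zero => rw [pow_zero, Module.End.one_apply, zero_smul, add_zero]
    | succ n ih =>
      rw [pow_succ', Module.End.mul_apply, ih, map_add, map_nsmul, hd, add_smul, one_smul]
      abel
  obtain ⟨k, hk⟩ := primaryTorsion_exists_pow_nsmul_eq_zero E p (ρ' σ a - a)
  exact ⟨k, by rw [hiter, hk, add_zero]⟩

/-- **`rank_{ℤ_p} T_p Q = 1`** for the inertia-coinvariant quotient `Q = E[p^∞] ⧸ D` at a multiplicative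
`w ∤ p`: `≤ 1` because `T_p E ↠ T_p Q` kills the non-zero element `σx − x` (rank–nullity over `ℚ_p` after
`ℚ_p ⊗ −`), `≥ 1` because `T_p Q ≠ 0`. [cite: SilvermanATAEC1994, Ex. 5.13 (a)]
[cite: GreenbergVatsal2000, §2, proof of Prop. 2.4 (arXiv p. 22)] -/
theorem finrank_tateModule_quotient_eq_one
    (hw : ((p : ℕ) : 𝓞 K) ∉ w.asIdeal) (hv : E.HasMultiplicativeReductionAt w)
    [Module.Finite ℤ_[p] (TateModule (PrimaryTorsion (geomPoints E) p ⧸ (Submodule.span ℤ_[p] {x : PrimaryTorsion (geomPoints E) p |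
        ∃ σ ∈ absInertia (w.adicCompletion K), ∃ a, x = ((E.primaryTorsionGaloisRep p).restrict (localMap K (Sum.inl w)) :
        ContinuousRep (absoluteGaloisGroup (w.adicCompletion K)) ℤ_[p] (PrimaryTorsion (geomPoints E) p)) σ a - a})) p)]
    [Module.Free ℤ_[p] (TateModule (PrimaryTorsion (geomPoints E) p ⧸ (Submodule.span ℤ_[p] {x : PrimaryTorsion (geomPoints E) p |
        ∃ σ ∈ absInertia (w.adicCompletion K), ∃ a, x = ((E.primaryTorsionGaloisRep p).restrict (localMap K (Sum.inl w)) :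
        ContinuousRep (absoluteGaloisGroup (w.adicCompletion K)) ℤ_[p] (PrimaryTorsion (geomPoints E) p)) σ a - a})) p)] :
    Module.finrank ℤ_[p] (TateModule (PrimaryTorsion (geomPoints E) p ⧸ (Submodule.span ℤ_[p] {x : PrimaryTorsion (geomPoints E) p |
        ∃ σ ∈ absInertia (w.adicCompletion K), ∃ a, x = ((E.primaryTorsionGaloisRep p).restrict (localMap K (Sum.inl w)) :
        ContinuousRep (absoluteGaloisGroup (w.adicCompletion K)) ℤ_[p] (PrimaryTorsion (geomPoints E) p)) σ a - a})) p) = 1 := by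
  set ρ' : ContinuousRep (absoluteGaloisGroup (w.adicCompletion K)) ℤ_[p] (PrimaryTorsion (geomPoints E) p) :=
    (E.primaryTorsionGaloisRep p).restrict (localMap K (Sum.inl w)) with hρ'
  set D := (Submodule.span ℤ_[p] {x : PrimaryTorsion (geomPoints E) p |
        ∃ σ ∈ absInertia (w.adicCompletion K), ∃ a, x = ρ' σ a - a}) with hD
  haveI := module_free_tateModule_holds E p
  haveI := module_finite_tateModule_holds E p
  have hpK : (p : K) ≠ 0 := by exact_mod_cast (Fact.out : p.Prime).ne_zero
  -- lower bound
  obtain ⟨t₀, ht₀⟩ := exists_tateModule_quotient_ne_zero E p hw hv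
  haveI : Nontrivial (TateModule (PrimaryTorsion (geomPoints E) p ⧸ D) p) := ⟨⟨t₀, 0, ht₀⟩⟩
  have hpos : 0 < Module.finrank ℤ_[p] (TateModule (PrimaryTorsion (geomPoints E) p ⧸ D) p) :=
    Module.finrank_pos
  -- upper bound: the surjection `L : T_p E → T_p Q` with a non-zero kernel element, tensored with `ℚ_p`
  obtain ⟨e8, he8⟩ := TateModule.exists_linearEquiv_primaryTorsion (geomPoints E) p
  set πT := TateModule.map p D.mkQ.toAddMonoidHom with hπT
  let L : E.tateModule p →ₗ[ℤ_[p]] TateModule (PrimaryTorsion (geomPoints E) p ⧸ D) p :=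
    πT ∘ₗ e8.symm.toLinearMap
  have hLsurj : Function.Surjective L := fun t => by
    obtain ⟨s, hs⟩ := tateModule_mkQ_surjective E p t
    exact ⟨e8 s, by rw [LinearMap.comp_apply, LinearEquiv.coe_toLinearMap, e8.symm_apply_apply]; exact hs⟩
  -- a non-zero kernel element `σ • x − x`
  obtain ⟨σ, hσ, a, ha⟩ := exists_absInertia_primaryTorsionGaloisRep_ne E p hw hv
  obtain ⟨n, hn⟩ := a.exists_pow_smul_eq_zero
  have ha' : (a : geomPoints E) ∈ geomTorsion E ((p ^ n : ℕ) : ℤ) := by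
    rw [mem_geomTorsion_iff, natCast_zsmul]; exact hn
  obtain ⟨x, hx⟩ := proj_surjective_of_isAlgClosed_holds E p n ha'
  have hk0 : localMap K (Sum.inl w) σ • x - x ≠ 0 := by
    intro h0
    apply ha
    apply PrimaryTorsion.ext
    have := congrArg (TateModule.proj p n) h0
    rw [map_sub, TateModule.proj_smul_of_distribMulAction, hx, map_zero, sub_eq_zero] at this
    exact this
  have hnat : ∀ (u : TateModule (PrimaryTorsion (geomPoints E) p) p),
      e8.symm (localMap K (Sum.inl w) σ • e8 u) = TateModule.map p (ρ' σ).toAddMonoidHom u := by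
    intro u
    apply e8.injective
    rw [LinearEquiv.apply_symm_apply, TateModule.linearEquiv_primaryTorsion_map e8 he8
      (ρ' σ).toAddMonoidHom (DistribSMul.toAddMonoidHom (geomPoints E) (localMap K (Sum.inl w) σ))
      (fun _ => rfl)]
    exact TateModule.ext fun k => by
      rw [TateModule.proj_smul_of_distribMulAction, TateModule.proj_map]; rfl
  have hLk0 : L (localMap K (Sum.inl w) σ • x - x) = 0 := by
    have hx' : x = e8 (e8.symm x) := (e8.apply_symm_apply x).symm
    change πT (e8.symm (localMap K (Sum.inl w) σ • x - x)) = 0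
    conv_lhs => rw [hx']
    rw [map_sub, hnat, LinearEquiv.symm_apply_apply, map_sub, sub_eq_zero, hπT, ← LinearMap.comp_apply,
      ← TateModule.map_comp]
    refine TateModule.ext fun k => ?_
    rw [TateModule.proj_map, TateModule.proj_map, AddMonoidHom.comp_apply, LinearMap.toAddMonoidHom_coe,
      LinearMap.toAddMonoidHom_coe, Submodule.mkQ_apply, Submodule.mkQ_apply]
    exact (Submodule.Quotient.eq _).mpr (Submodule.subset_span ⟨σ, hσ, _, rfl⟩)
  -- tensor with `ℚ_p` and count dimensions
  let LQ := L.baseChange ℚ_[p]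
  have hLQsurj : Function.Surjective LQ := by
    rw [← LinearMap.range_eq_top, LinearMap.range_eq_top]
    change Function.Surjective (L.baseChange ℚ_[p])
    rw [LinearMap.baseChange_eq_ltensor]
    exact LinearMap.lTensor_surjective ℚ_[p] hLsurj
  have hker : LinearMap.ker LQ ≠ ⊥ := by
    intro hbot
    have hmem : LQ ((1 : ℚ_[p]) ⊗ₜ[ℤ_[p]] (localMap K (Sum.inl w) σ • x - x)) = 0 := by
      change L.baseChange ℚ_[p] ((1 : ℚ_[p]) ⊗ₜ[ℤ_[p]] (localMap K (Sum.inl w) σ • x - x)) = 0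
      rw [LinearMap.baseChange_tmul, hLk0, TensorProduct.tmul_zero]
    have hinj : Function.Injective LQ := LinearMap.ker_eq_bot.mp hbot
    have h0 : ((1 : ℚ_[p]) ⊗ₜ[ℤ_[p]] (localMap K (Sum.inl w) σ • x - x) : ℚ_[p] ⊗[ℤ_[p]] E.tateModule p) = 0 :=
      hinj (by rw [hmem, map_zero])
    refine hk0 (TateModule.toRational_injective ?_)
    rw [TateModule.toRational_apply, map_zero]
    exact h0
  have hsum := LinearMap.finrank_range_add_finrank_ker LQ
  rw [LinearMap.range_eq_top.mpr hLQsurj, finrank_top] at hsum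
  have hV : Module.finrank ℚ_[p] (RationalTateModule (geomPoints E) p) = 2 :=
    finrank_rationalTateModule_eq_two_holds E p (Nat.cast_ne_zero.mpr (Fact.out : p.Prime).ne_zero)
  change Module.finrank ℚ_[p] (ℚ_[p] ⊗[ℤ_[p]] TateModule (PrimaryTorsion (geomPoints E) p ⧸ D) p) +
    Module.finrank ℚ_[p] (LinearMap.ker LQ) = Module.finrank ℚ_[p] (RationalTateModule (geomPoints E) p) at hsum
  rw [hV, Module.finrank_baseChange] at hsum
  have hkpos : 0 < Module.finrank ℚ_[p] (LinearMap.ker LQ) := by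
    rw [pos_iff_ne_zero]
    intro h0
    exact hker (Submodule.finrank_eq_zero.mp h0)
  omega

end Mult

end Summit.BirchSwinnertonDyer.BirchSwinnertonDyer.Theorems.SigmaLocal

end
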